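import Summits.NavierStokesRegularity.NavierStokesRegularity.Theorems.CalmSliceGateOneSymmetricSlice
import Summits.NavierStokesRegularity.NavierStokesRegularity.Theorems.SqueezeCycleExtremalBiaxialitySubcriticalGaugeStrainBound
import Summits.NavierStokesRegularity.NavierStokesRegularity.Theorems.CalmSliceGateAsymmetricFlickerLiouvilleKilling
import Literature.Analysis.FluidPDE.PeriodicCylinderNeumannWeakTangential
import HarnessLib

/-!
# Route `CalmSliceGate`, converter `OneSymmetricSlice` (stmt-NavierStokesRegularity-24452, PROVED):
# the ONE-SLICE QUANTISED-ORDER corollary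

Theorems file (seat ns-lqd-p2 g7, cell ns-idea-3; `--supports` item 24452; the corollary noted by
the route's planner ns-idea-3 g3, 2026-08-28T03:15Z, "free Theorems file for anyone").
Navier–Stokes regularity is NOT proved by anything here; no summit is.

`OneSymmetricSlice` (`Theorems.oneSymmetricSlice_proof`): for all `C, K` there are `δ', R' > 0`
such that a member `w` of the stratum `𝒟_{C,K}` (Type-I ancient mild field in the KNSS gauge with
the quarter-rate dissipation law) ONE of whose slices `t < 0` is `δ'`-almost axisymmetric about SOME
apex axis `g·e₃` (`g ∈ O(3)`) on the core ball `B(0, R'√(−t))` is regular at the apex. Replacing the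
continuous rotation group by a FINITE cyclic group of large order costs nothing:

* `oneQuantisedSlice` — for all `C, K` there are `N ∈ ℕ`, `δ > 0`, `R > 0` such that a member of
  `𝒟_{C,K}` ONE of whose slices `t < 0` is `δ`-almost `C_n`-EQUIVARIANT about some apex axis on
  `B(0, R√(−t))` — `√(−t)‖w(t, gR_{2πk/n}g⁻¹x) − gR_{2πk/n}g⁻¹w(t,x)‖ ≤ δ` for all integers `k`
  and all `x` in the ball — with `n ≥ N` is bounded on some backward cylinder at the origin;
* `oneExactlyQuantisedSlice` — in particular ONE slice which is EXACTLY `C_n`-symmetric about some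
  apex axis (`w(t, gR_{2π/n}g⁻¹x) = gR_{2π/n}g⁻¹ w(t,x)` for all `x`; all powers follow) with
  `n ≥ N(C,K)` forces regularity at the apex;
* `quantisedOrder_floor_of_singular` — contrapositive: a SINGULAR member of `𝒟_{C,K}` admits, at NO
  instant, an approximate cyclic symmetry of order `≥ N(C,K)` about any apex axis.

Mechanism (elementary, on top of the proved converter): write `θ = 2πk/n + φ`, `|φ| ≤ π/n`
(`k = round(θn/2π)`); then `w(gR_θg⁻¹x) − gR_θg⁻¹w(x) = [w(gR_αg⁻¹y) − gR_αg⁻¹w(y)] +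
gR_αg⁻¹[(w(y) − w(x)) + (w(x) − gR_φg⁻¹w(x))]` with `y = gR_φg⁻¹x`, `α = 2πk/n`; the first bracket
is the cyclic defect, the second is `≤ (K₀R' + C)|φ|/√(−t)` by the class-uniform gauge gradient bound
`(−t)‖∇w(t)‖ ≤ K₀(C)` (`exists_gauge_norm_fderiv_le_of_typeI`), `‖R_φv − v‖ ≤ |φ|‖v‖`
(`norm_rotZ_sub_self_le`) and the Type-I bound. Hence `N = ⌈2π(K₀R'+C)/δ'⌉ + 1`, `δ = δ'/2`,
`R = R'`. Compare the all-slices AB-class theorem `QuantisedSymmetryQuantisedOrder` (item 11293).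

References: Seregin–Šverák 2009, Thm. 3.1 (through `OneSymmetricSlice`); Koch–Nadirashvili–
Seregin–Šverák 2009, Prop. 4.1 / (4.10) (the gradient bound).
-/

noncomputable section

-- the summit and its single sub-problem share the name (CONVENTIONS §1), as in every Theorems file
set_option linter.dupNamespace false

namespace Summit.NavierStokesRegularity.NavierStokesRegularity.Theorems.OneSymmetricSlice.Quantised

open MeasureTheory Set Filter Topology Metric Function Real
open Literature.Analysis Literature.Analysis.FluidPDE
open Summit.NavierStokesRegularity.NavierStokesRegularity.Theorems
open scoped ENNReal NNReal

/-! ### Elementary tools -/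

/-- **Nearest lattice angle**: every `θ` is within `π/n` of an angle `2πk/n`, `k ∈ ℤ` (`n ≥ 1`):
`k = round(θ n / 2π)`. [folklore] -/
theorem exists_int_near_angle {n : ℕ} (hn : 0 < n) (θ : ℝ) :
    ∃ k : ℤ, |θ - 2 * π * k / n| ≤ π / n := by
  have hn' : (0 : ℝ) < n := by exact_mod_cast hn
  have h2π : 0 < 2 * π := by positivity
  refine ⟨round (θ * n / (2 * π)), ?_⟩
  have hr := abs_sub_round (θ * n / (2 * π))
  have e : θ - 2 * π * (round (θ * n / (2 * π)) : ℝ) / n =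
      (2 * π / n) * (θ * n / (2 * π) - round (θ * n / (2 * π))) := by
    field_simp
  rw [e, abs_mul, abs_of_pos (by positivity : (0 : ℝ) < 2 * π / n)]
  calc 2 * π / n * |θ * n / (2 * π) - round (θ * n / (2 * π))| ≤ 2 * π / n * (1 / 2) :=
        mul_le_mul_of_nonneg_left hr (by positivity)
    _ = π / n := by ring

/-- Conjugated rotations compose: `g R_{a+b} g⁻¹ = (g R_a g⁻¹) ∘ (g R_b g⁻¹)`. [folklore] -/
theorem conj_rotZ_add (g : EuclideanSpace ℝ (Fin 3) ≃ₗᵢ[ℝ] EuclideanSpace ℝ (Fin 3)) (a b : ℝ)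
    (x : EuclideanSpace ℝ (Fin 3)) :
    g (rotZ (a + b) (g.symm x)) = g (rotZ a (g.symm (g (rotZ b (g.symm x))))) := by
  rw [LinearIsometryEquiv.symm_apply_apply, rotZ_add]

/-- The conjugated rotation is an isometry: `‖g R_a g⁻¹ x‖ = ‖x‖`. [folklore] -/
theorem norm_conj_rotZ (g : EuclideanSpace ℝ (Fin 3) ≃ₗᵢ[ℝ] EuclideanSpace ℝ (Fin 3)) (a : ℝ)
    (x : EuclideanSpace ℝ (Fin 3)) : ‖g (rotZ a (g.symm x))‖ = ‖x‖ := by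
  rw [LinearIsometryEquiv.norm_map, norm_rotZ, LinearIsometryEquiv.norm_map]

/-- The conjugated rotation is linear (subtraction). [folklore] -/
theorem conj_rotZ_sub (g : EuclideanSpace ℝ (Fin 3) ≃ₗᵢ[ℝ] EuclideanSpace ℝ (Fin 3)) (a : ℝ)
    (u v : EuclideanSpace ℝ (Fin 3)) :
    g (rotZ a (g.symm (u - v))) = g (rotZ a (g.symm u)) - g (rotZ a (g.symm v)) := by
  rw [map_sub, ← rotZLIE_apply, map_sub, map_sub, rotZLIE_apply, rotZLIE_apply]

/-- **Small conjugated rotations move points little**: `‖g R_φ g⁻¹ x − x‖ ≤ |φ| ‖x‖`. [folklore] -/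
theorem norm_conj_rotZ_sub_self_le (g : EuclideanSpace ℝ (Fin 3) ≃ₗᵢ[ℝ] EuclideanSpace ℝ (Fin 3))
    (φ : ℝ) (x : EuclideanSpace ℝ (Fin 3)) : ‖g (rotZ φ (g.symm x)) - x‖ ≤ |φ| * ‖x‖ := by
  have e : g (rotZ φ (g.symm x)) - x = g (rotZ φ (g.symm x) - g.symm x) := by
    rw [map_sub, LinearIsometryEquiv.apply_symm_apply]
  rw [e, LinearIsometryEquiv.norm_map]
  have h := PeriodicCylinder.norm_rotZ_sub_self_le φ (g.symm x)
  rwa [LinearIsometryEquiv.norm_map] at h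

/-! ### The quantised-order corollary -/

/-- **One almost-`C_n`-equivariant slice of large order ⇒ regular at the apex.** For all `C, K`
there are `N ∈ ℕ`, `δ > 0`, `R > 0` such that every member `w` of `𝒟_{C,K}` having ONE instant
`t < 0`, an apex axis `g·e₃` (`g` a linear isometry) and an order `n ≥ N` with
`√(−t)‖w(t, gR_{2πk/n}g⁻¹x) − gR_{2πk/n}g⁻¹ w(t,x)‖ ≤ δ` for all `k ∈ ℤ` and all
`x ∈ B(0, R√(−t))` is bounded on some backward cylinder at the origin (`θ = 2πk/n + φ`,
`|φ| ≤ π/n`, gauge gradient bound + Type I bound the `φ`-error by `(K₀R + C)π/n`; then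
`OneSymmetricSlice`). [cite: SereginSverak2009, Thm. 3.1] [cite: KochNadirashviliSereginSverak2009, Prop. 4.1 (4.10) (arXiv:0709.3599 p. 8)] -/
theorem oneQuantisedSlice : ∀ (C K : ℝ), ∃ N : ℕ, ∃ δ > 0, ∃ R > 0,
    ∀ (w : ℝ → EuclideanSpace ℝ (Fin 3) → EuclideanSpace ℝ (Fin 3)),
      IsTypeIAncientMild C w →
      (∀ s : ℝ, s < 0 → ∫⁻ x, ‖fderiv ℝ (w s) x‖ₑ ^ 2 ≤ ENNReal.ofReal (K / Real.sqrt (-s))) →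
      (∃ t < 0, ∃ g : EuclideanSpace ℝ (Fin 3) ≃ₗᵢ[ℝ] EuclideanSpace ℝ (Fin 3), ∃ n : ℕ, N ≤ n ∧
        ∀ k : ℤ, ∀ x ∈ ball (0 : EuclideanSpace ℝ (Fin 3)) (R * Real.sqrt (-t)),
          Real.sqrt (-t) * ‖w t (g (rotZ (2 * π * k / n) (g.symm x))) -
            g (rotZ (2 * π * k / n) (g.symm (w t x)))‖ ≤ δ) →
      ¬ (∀ r > 0, ∀ M : ℝ, ∃ t ∈ Ioo (-(r ^ 2)) (0 : ℝ),
        ∃ x ∈ ball (0 : EuclideanSpace ℝ (Fin 3)) r, M < ‖w t x‖) := by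
  intro C K
  -- the converter and the class-uniform gradient bound
  obtain ⟨δ', hδ', R', hR', hOSS⟩ := oneSymmetricSlice_proof C K
  obtain ⟨K₀', hK₀'⟩ := exists_gauge_norm_fderiv_le_of_typeI C
  set K₀ : ℝ := max K₀' 0 with hK₀
  have hK₀0 : 0 ≤ K₀ := le_max_right _ _
  have hK₀b : ∀ ⦃v : ℝ → EuclideanSpace ℝ (Fin 3) → EuclideanSpace ℝ (Fin 3)⦄,
      IsTypeIAncientMild C v → ∀ t < 0, ∀ x, (-t) * ‖fderiv ℝ (v t) x‖ ≤ K₀ :=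
    fun v hv t ht x => (hK₀' hv t ht x).trans (le_max_left _ _)
  -- the constants
  set N : ℕ := Nat.ceil (2 * π * (K₀ * R' + max C 0) / δ') + 1 with hN
  refine ⟨N, δ' / 2, by positivity, R', hR', ?_⟩
  intro w hw hlaw ⟨t, ht, g, n, hNn, hcyc⟩
  have hC : 0 ≤ C := hw.nonneg
  have hCmax : max C 0 = C := max_eq_left hC
  have hst : 0 < Real.sqrt (-t) := Real.sqrt_pos.2 (neg_pos.2 ht)
  have hnpos : 0 < n := lt_of_lt_of_le (Nat.succ_pos _) hNn
  have hn' : (0 : ℝ) < n := by exact_mod_cast hnpos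
  -- `π (K₀ R' + C)/n ≤ δ'/2`
  have hNreal : 2 * π * (K₀ * R' + C) / δ' ≤ (n : ℝ) - 1 := by
    have h1 : (Nat.ceil (2 * π * (K₀ * R' + max C 0) / δ') : ℝ) + 1 ≤ n := by
      have : (N : ℝ) ≤ n := by exact_mod_cast hNn
      rw [hN] at this; push_cast at this; exact this
    have h2 := Nat.le_ceil (2 * π * (K₀ * R' + max C 0) / δ')
    rw [hCmax] at h2 h1
    linarith
  have hsmallφ : π / n * (K₀ * R' + C) ≤ δ' / 2 := by
    have hKC : 0 ≤ K₀ * R' + C := by positivity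
    have h1 : 2 * π * (K₀ * R' + C) ≤ ((n : ℝ) - 1) * δ' := (div_le_iff₀ hδ').1 hNreal
    have h2 : ((n : ℝ) - 1) * δ' ≤ n * δ' := by nlinarith
    have h3 : π * (K₀ * R' + C) ≤ n * (δ' / 2) := by nlinarith
    calc π / n * (K₀ * R' + C) = (π * (K₀ * R' + C)) / n := by ring
      _ ≤ (n * (δ' / 2)) / n := div_le_div_of_nonneg_right h3 hn'.le
      _ = δ' / 2 := by field_simp
  -- ## the almost-axisymmetry hypothesis of `OneSymmetricSlice`
  refine hOSS w hw hlaw ⟨t, ht, g, fun θ x hx => ?_⟩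
  obtain ⟨k, hk⟩ := exists_int_near_angle hnpos θ
  set α : ℝ := 2 * π * k / n with hα
  set φ : ℝ := θ - α with hφ
  have hφle : |φ| ≤ π / n := hk
  have hθ : θ = α + φ := by rw [hφ]; ring
  set y : EuclideanSpace ℝ (Fin 3) := g (rotZ φ (g.symm x)) with hy
  have hyn : ‖y‖ = ‖x‖ := norm_conj_rotZ g φ x
  have hxR : ‖x‖ < R' * Real.sqrt (-t) := mem_ball_zero_iff.1 hx
  have hyB : y ∈ ball (0 : EuclideanSpace ℝ (Fin 3)) (R' * Real.sqrt (-t)) := by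
    rw [mem_ball_zero_iff, hyn]; exact hxR
  -- decomposition of the defect
  have e1 : w t (g (rotZ θ (g.symm x))) = w t (g (rotZ α (g.symm y))) := by
    rw [hθ, conj_rotZ_add]
  have e2 : g (rotZ θ (g.symm (w t x))) = g (rotZ α (g.symm (g (rotZ φ (g.symm (w t x)))))) := by
    rw [hθ, conj_rotZ_add]
  have hdec : w t (g (rotZ θ (g.symm x))) - g (rotZ θ (g.symm (w t x))) =
      (w t (g (rotZ α (g.symm y))) - g (rotZ α (g.symm (w t y)))) +
        g (rotZ α (g.symm (w t y - g (rotZ φ (g.symm (w t x)))))) := by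
    rw [e1, e2, conj_rotZ_sub]; abel
  -- the cyclic part
  have hcyc' : Real.sqrt (-t) * ‖w t (g (rotZ α (g.symm y))) - g (rotZ α (g.symm (w t y)))‖ ≤ δ' / 2 :=
    hcyc k y hyB
  -- the `φ`-error: gradient part
  have hgrad : ‖w t y - w t x‖ ≤ K₀ / (-t) * (|φ| * ‖x‖) := by
    have hdiff : ∀ z ∈ (univ : Set (EuclideanSpace ℝ (Fin 3))), DifferentiableAt ℝ (w t) z :=
      fun z _ => ((hw.contDiff_slice ht).differentiable (by simp)).differentiableAt
    have hbd : ∀ z ∈ (univ : Set (EuclideanSpace ℝ (Fin 3))), ‖fderiv ℝ (w t) z‖ ≤ K₀ / (-t) := by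
      intro z _
      rw [le_div_iff₀ (neg_pos.2 ht), mul_comm]
      exact hK₀b hw t ht z
    have hmv := Convex.norm_image_sub_le_of_norm_fderiv_le hdiff hbd convex_univ (mem_univ x)
      (mem_univ y)
    refine hmv.trans (mul_le_mul_of_nonneg_left ?_ (div_nonneg hK₀0 (neg_pos.2 ht).le))
    rw [hy]
    exact norm_conj_rotZ_sub_self_le g φ x
  -- the `φ`-error: rotation of the value
  have hrot : ‖w t x - g (rotZ φ (g.symm (w t x)))‖ ≤ |φ| * (C / Real.sqrt (-t)) := by
    rw [norm_sub_rev]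
    refine (norm_conj_rotZ_sub_self_le g φ (w t x)).trans ?_
    exact mul_le_mul_of_nonneg_left (hw.norm_le ht x) (abs_nonneg _)
  have hsecond : ‖g (rotZ α (g.symm (w t y - g (rotZ φ (g.symm (w t x))))))‖ ≤
      K₀ / (-t) * (|φ| * ‖x‖) + |φ| * (C / Real.sqrt (-t)) := by
    rw [norm_conj_rotZ]
    calc ‖w t y - g (rotZ φ (g.symm (w t x)))‖
        ≤ ‖w t y - w t x‖ + ‖w t x - g (rotZ φ (g.symm (w t x)))‖ := norm_sub_le_norm_sub_add_norm_sub _ _ _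
      _ ≤ _ := add_le_add hgrad hrot
  -- assemble, scaled by `√(−t)`
  have hsq : Real.sqrt (-t) * Real.sqrt (-t) = -t := Real.mul_self_sqrt (neg_pos.2 ht).le
  have hφerr : Real.sqrt (-t) * (K₀ / (-t) * (|φ| * ‖x‖) + |φ| * (C / Real.sqrt (-t))) ≤
      π / n * (K₀ * R' + C) := by
    have h1 : Real.sqrt (-t) * (K₀ / (-t) * (|φ| * ‖x‖)) ≤ |φ| * (K₀ * R') := by
      have hxle : ‖x‖ ≤ R' * Real.sqrt (-t) := hxR.le
      calc Real.sqrt (-t) * (K₀ / (-t) * (|φ| * ‖x‖))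
          ≤ Real.sqrt (-t) * (K₀ / (-t) * (|φ| * (R' * Real.sqrt (-t)))) :=
            mul_le_mul_of_nonneg_left (mul_le_mul_of_nonneg_left
              (mul_le_mul_of_nonneg_left hxle (abs_nonneg _))
              (div_nonneg hK₀0 (neg_pos.2 ht).le)) hst.le
        _ = |φ| * (K₀ * R') * (Real.sqrt (-t) * Real.sqrt (-t) / (-t)) := by ring
        _ = |φ| * (K₀ * R') := by rw [hsq, div_self (neg_pos.2 ht).ne', mul_one]
    have h2 : Real.sqrt (-t) * (|φ| * (C / Real.sqrt (-t))) = |φ| * C := by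
      field_simp
    rw [mul_add, h2]
    have h3 : |φ| * (K₀ * R') + |φ| * C = |φ| * (K₀ * R' + C) := by ring
    calc Real.sqrt (-t) * (K₀ / (-t) * (|φ| * ‖x‖)) + |φ| * C ≤ |φ| * (K₀ * R') + |φ| * C := by
          linarith
      _ = |φ| * (K₀ * R' + C) := h3
      _ ≤ π / n * (K₀ * R' + C) := mul_le_mul_of_nonneg_right hφle (by positivity)
  calc Real.sqrt (-t) * ‖w t (g (rotZ θ (g.symm x))) - g (rotZ θ (g.symm (w t x)))‖
      = Real.sqrt (-t) * ‖(w t (g (rotZ α (g.symm y))) - g (rotZ α (g.symm (w t y)))) +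
          g (rotZ α (g.symm (w t y - g (rotZ φ (g.symm (w t x))))))‖ := by rw [hdec]
    _ ≤ Real.sqrt (-t) * (‖w t (g (rotZ α (g.symm y))) - g (rotZ α (g.symm (w t y)))‖ +
          ‖g (rotZ α (g.symm (w t y - g (rotZ φ (g.symm (w t x))))))‖) :=
        mul_le_mul_of_nonneg_left (norm_add_le _ _) hst.le
    _ ≤ δ' / 2 + Real.sqrt (-t) * (K₀ / (-t) * (|φ| * ‖x‖) + |φ| * (C / Real.sqrt (-t))) := by
        rw [mul_add]
        exact add_le_add hcyc' (mul_le_mul_of_nonneg_left hsecond hst.le)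
    _ ≤ δ' / 2 + δ' / 2 := by linarith [hφerr.trans hsmallφ]
    _ = δ' := by ring

/-- **One EXACTLY `C_n`-symmetric slice of large order ⇒ regular at the apex.** With the
`N = N(C,K)` of `oneQuantisedSlice`: if ONE slice `t < 0` of a member of `𝒟_{C,K}` satisfies
`w(t, gR_{2π/n}g⁻¹x) = gR_{2π/n}g⁻¹ w(t,x)` for all `x` (cyclic symmetry of order `n ≥ N` about
the apex axis `g·e₃`), the member is bounded on some backward cylinder at the origin (the symmetry
under the generator propagates to all powers `R_{2πk/n}`, `k ∈ ℤ`, by induction and periodicity).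
[cite: SereginSverak2009, Thm. 3.1] -/
theorem oneExactlyQuantisedSlice : ∀ (C K : ℝ), ∃ N : ℕ,
    ∀ (w : ℝ → EuclideanSpace ℝ (Fin 3) → EuclideanSpace ℝ (Fin 3)),
      IsTypeIAncientMild C w →
      (∀ s : ℝ, s < 0 → ∫⁻ x, ‖fderiv ℝ (w s) x‖ₑ ^ 2 ≤ ENNReal.ofReal (K / Real.sqrt (-s))) →
      (∃ t < 0, ∃ g : EuclideanSpace ℝ (Fin 3) ≃ₗᵢ[ℝ] EuclideanSpace ℝ (Fin 3), ∃ n : ℕ, N ≤ n ∧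
        ∀ x, w t (g (rotZ (2 * π / n) (g.symm x))) = g (rotZ (2 * π / n) (g.symm (w t x)))) →
      ¬ (∀ r > 0, ∀ M : ℝ, ∃ t ∈ Ioo (-(r ^ 2)) (0 : ℝ),
        ∃ x ∈ ball (0 : EuclideanSpace ℝ (Fin 3)) r, M < ‖w t x‖) := by
  intro C K
  obtain ⟨N, δ, hδ, R, hR, h⟩ := oneQuantisedSlice C K
  refine ⟨N, fun w hw hlaw ⟨t, ht, g, n, hNn, hsym⟩ => h w hw hlaw ⟨t, ht, g, n, hNn, ?_⟩⟩
  rcases Nat.eq_zero_or_pos n with hn0 | hnpos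
  · -- degenerate order `n = 0`: the cyclic hypothesis is void (`R_{2πk/0} = R_0 = id`)
    intro k x _
    subst hn0
    simp only [Nat.cast_zero, div_zero, rotZ_zero, LinearIsometryEquiv.apply_symm_apply, sub_self,
      norm_zero, mul_zero]
    exact hδ.le
  have hn' : (n : ℝ) ≠ 0 := by exact_mod_cast hnpos.ne'
  -- all natural powers
  have hnat : ∀ (m : ℕ) (x : EuclideanSpace ℝ (Fin 3)),
      w t (g (rotZ (2 * π * m / n) (g.symm x))) = g (rotZ (2 * π * m / n) (g.symm (w t x))) := by
    intro m
    induction m with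
    | zero =>
        intro x
        simp [rotZ_zero]
    | succ m ih =>
        intro x
        have e : 2 * π * ((m + 1 : ℕ) : ℝ) / n = 2 * π / n + 2 * π * m / n := by
          push_cast; ring
        rw [e, conj_rotZ_add, hsym, ih, ← conj_rotZ_add]
  -- all integer powers, by periodicity
  have hint : ∀ (k : ℤ) (x : EuclideanSpace ℝ (Fin 3)),
      w t (g (rotZ (2 * π * k / n) (g.symm x))) = g (rotZ (2 * π * k / n) (g.symm (w t x))) := by
    intro k x
    have hn0 : (n : ℤ) ≠ 0 := by exact_mod_cast hnpos.ne'
    set m : ℤ := k % n with hm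
    set q : ℤ := k / n with hq
    have hm0 : 0 ≤ m := Int.emod_nonneg _ hn0
    have hkq : k = m + n * q := by rw [hm, hq]; linarith [Int.emod_add_mul_ediv k n]
    have e : 2 * π * (k : ℝ) / n = 2 * π * ((m.toNat : ℕ) : ℝ) / n + q * (2 * π) := by
      have : ((m.toNat : ℕ) : ℝ) = (m : ℝ) := by exact_mod_cast Int.toNat_of_nonneg hm0
      rw [this, hkq]; push_cast; field_simp
    rw [e, AsymmetricFlickerLiouville.Birth.rotZ_add_int_mul_two_pi,
      AsymmetricFlickerLiouville.Birth.rotZ_add_int_mul_two_pi]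
    exact hnat m.toNat x
  intro k x _
  rw [hint k x, sub_self, norm_zero, mul_zero]
  exact hδ.le

/-- **No approximate cyclic symmetry of large order at any instant of a singular member**
(contrapositive of `oneQuantisedSlice`): for a SINGULAR member of `𝒟_{C,K}`, every `t < 0`,
every apex axis `g` and every order `n ≥ N(C,K)`, some power `R_{2πk/n}` and some
`x ∈ B(0, R√(−t))` carry cyclic defect `> δ/√(−t)`. [cite: SereginSverak2009, Thm. 3.1] -/
theorem quantisedOrder_floor_of_singular : ∀ (C K : ℝ), ∃ N : ℕ, ∃ δ > 0, ∃ R > 0,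
    ∀ (w : ℝ → EuclideanSpace ℝ (Fin 3) → EuclideanSpace ℝ (Fin 3)),
      IsTypeIAncientMild C w →
      (∀ s : ℝ, s < 0 → ∫⁻ x, ‖fderiv ℝ (w s) x‖ₑ ^ 2 ≤ ENNReal.ofReal (K / Real.sqrt (-s))) →
      (∀ r > 0, ∀ M : ℝ, ∃ t ∈ Ioo (-(r ^ 2)) (0 : ℝ),
        ∃ x ∈ ball (0 : EuclideanSpace ℝ (Fin 3)) r, M < ‖w t x‖) →
      ∀ t < 0, ∀ (g : EuclideanSpace ℝ (Fin 3) ≃ₗᵢ[ℝ] EuclideanSpace ℝ (Fin 3)) (n : ℕ), N ≤ n →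
        ∃ k : ℤ, ∃ x ∈ ball (0 : EuclideanSpace ℝ (Fin 3)) (R * Real.sqrt (-t)),
          δ < Real.sqrt (-t) * ‖w t (g (rotZ (2 * π * k / n) (g.symm x))) -
            g (rotZ (2 * π * k / n) (g.symm (w t x)))‖ := by
  intro C K
  obtain ⟨N, δ, hδ, R, hR, h⟩ := oneQuantisedSlice C K
  refine ⟨N, δ, hδ, R, hR, fun w hw hlaw hsing t ht g n hNn => ?_⟩
  by_contra hle
  push Not at hle
  exact h w hw hlaw ⟨t, ht, g, n, hNn, fun k x hx => hle k x hx⟩ hsing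

end Summit.NavierStokesRegularity.NavierStokesRegularity.Theorems.OneSymmetricSlice.Quantised

end
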